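import Mathlib
import HarnessLib
import Summits.HubbardSuperconductivity.HubbardSuperconductivity.Theorems.KLProgrammeC4aPPKernelTrueFlatnessShape

/-!
# Route `KLProgramme` — crux C4a, S3 brick (B4) «(B4)-UMK1», «(M1)-TRUE-KERNEL» adaptation (window): the FINITE MATSUBARA WINDOW `n < M` of the true numerator —
# split `N = N_M + N_tail`, derivatives of both parts, and the tail's gradient `≤ (12B₁ + 5)/ω_M` (`ω_M = (2M+1)π/β`)

Cell `gate-hubbard-kl`, seat hubbard-kl-k3c3-p1 (g15; row «δμ-flow with klAngularMean constant piece»).  Companion of `…C4aPPKernelTrueNumerator(Far)` /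
`…TrueFlatnessShape` (stub (C) of stmt-HubbardSuperconductivity-20437; note `M1-TRUE-KERNEL.md` §5 residual «finite window»).  Lattice regularisations carry the
TRUNCATED frequency set `n < M` (`MatsubaraIdx M`); the window numerator is the all-frequency one minus a tail whose summands have no shell structure left
(`ωₙ ≥ ω_M`) and are `O((12B₁+5)/ωₙ²)`:
* §1 `ppSummand`, `ppSummandDu` (one term of `N` / of `∂ᵤN`), `ppWindowNumerator(Du)`, `ppTailNumerator(Du)`; `ppTrueNumerator_eq_window_add_tail`, `…Du_eq_window_add_tail`;
* §2 `hasDerivAt_ppSummand_u`, **`hasDerivAt_ppWindowNumerator_u`**, **`hasDerivAt_ppTailNumerator_u`** (and `_e` versions by symmetry);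
* §3 `abs_ppSummandDu_le_unif` (`≤ (12B₁+5)/(ωₙ²+Λ²)`), **`abs_ppTailNumeratorDu_le`**: `|∂ᵤN_tail|, |∂ₑN_tail| ≤ (12B₁ + 5)/ω_M` (count-free: `ωₙ ≥ ω_M ⟹ 1/(ωₙ²+Λ²) ≤
  2/(ωₙ²+ω_M²)`, summed by the tanh closed form).
The flatness consequences (`|N_tail| ≤ S_M(e+u)`, tail flatness `≤ S_M(2κ₀+κ₁)`, window kernel `≤ A₁Λ/max(D,Λ)² + S_M(2κ₀+κ₁)`) are `…C4aPPKernelWindowFlatness`.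
Pure real analysis; nothing asserts (C), K3 or superconductivity.
References: BGM 2006 §2.1 (2.3)–(2.4) [cite: BenfattoGiulianiMastropietro2006]; Salmhofer 1999 §4.2.5 [cite: Salmhofer1999].
-/

noncomputable section

namespace Summit.HubbardSuperconductivity.HubbardSuperconductivity.Theorems.C4a

set_option linter.dupNamespace false -- summit = problem name (single-conjunct summit), D-0017

open Real Filter Set Finset
open scoped Topology
open Literature.MathematicalPhysics.QuantumLattice Literature.Analysis.SpecialFunctions

/-! ## §1 Summands, window and tail -/

/-- One summand of the true numerator: `W(ωₙ,e)W(ωₙ,u)[e/(ωₙ²+e²) + u/(ωₙ²+u²)]`. -/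
def ppSummand (β Λ e u : ℝ) (n : ℕ) : ℝ :=
  uvWeightFn Λ (ppFreq β n) e * uvWeightFn Λ (ppFreq β n) u * (e / (ppFreq β n ^ 2 + e ^ 2) + u / (ppFreq β n ^ 2 + u ^ 2))

/-- One summand of `∂ᵤN`: `W(ωₙ,e)[W′(ωₙ,u)(e/(ωₙ²+e²) + u/(ωₙ²+u²)) + W(ωₙ,u)(ωₙ²−u²)/(ωₙ²+u²)²]`. -/
def ppSummandDu (β Λ e u : ℝ) (n : ℕ) : ℝ :=
  uvWeightFn Λ (ppFreq β n) e * (uvWeightFnD1 Λ (ppFreq β n) u * (e / (ppFreq β n ^ 2 + e ^ 2) + u / (ppFreq β n ^ 2 + u ^ 2)) +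
    uvWeightFn Λ (ppFreq β n) u * ((ppFreq β n ^ 2 - u ^ 2) / (ppFreq β n ^ 2 + u ^ 2) ^ 2))

/-- The window numerator `N_M = (2/β)Σ_{n<M}`. -/
def ppWindowNumerator (β Λ : ℝ) (M : ℕ) (e u : ℝ) : ℝ := 2 / β * ∑ n ∈ Finset.range M, ppSummand β Λ e u n

/-- The window's `∂ᵤ`. -/
def ppWindowNumeratorDu (β Λ : ℝ) (M : ℕ) (e u : ℝ) : ℝ := 2 / β * ∑ n ∈ Finset.range M, ppSummandDu β Λ e u n

/-- The tail numerator `N_tail = (2/β)Σ_{n≥M}`. -/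
def ppTailNumerator (β Λ : ℝ) (M : ℕ) (e u : ℝ) : ℝ := 2 / β * ∑' n : ℕ, ppSummand β Λ e u (n + M)

/-- The tail's `∂ᵤ`. -/
def ppTailNumeratorDu (β Λ : ℝ) (M : ℕ) (e u : ℝ) : ℝ := 2 / β * ∑' n : ℕ, ppSummandDu β Λ e u (n + M)

/-- `N = (2/β)Σ ppSummand`. [folklore] -/
theorem ppTrueNumerator_eq_tsum_ppSummand (β Λ e u : ℝ) : ppTrueNumerator β Λ e u = 2 / β * ∑' n : ℕ, ppSummand β Λ e u n := rfl

/-- `∂ᵤN = (2/β)Σ ppSummandDu`. [folklore] -/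
theorem ppTrueNumeratorDu_eq_tsum_ppSummandDu (β Λ e u : ℝ) : ppTrueNumeratorDu β Λ e u = 2 / β * ∑' n : ℕ, ppSummandDu β Λ e u n := rfl

/-- The summand is symmetric in the two levels. [folklore] -/
theorem ppSummand_symm (β Λ e u : ℝ) (n : ℕ) : ppSummand β Λ e u n = ppSummand β Λ u e n := by unfold ppSummand; ring

/-- Summability of the summands at fixed levels (`|term| ≤ (|e|+|u|)/ωₙ²`). [folklore] -/
theorem summable_ppSummand {β : ℝ} (hβ : 0 < β) (Λ e u : ℝ) : Summable (ppSummand β Λ e u) := by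
  have hω : ∀ n : ℕ, 0 < ppFreq β n := ppFreq_pos hβ
  refine Summable.of_norm_bounded (((summable_one_div_ppFreq_sq_add_sq hβ 0).mul_left (|e| + |u|))) fun n => ?_
  rw [Real.norm_eq_abs, ppSummand, abs_mul, abs_mul, zero_pow two_ne_zero, add_zero]
  have h1 := abs_lorentzian_le_abs_div_sq (hω n).ne' e
  have h2 := abs_lorentzian_le_abs_div_sq (hω n).ne' u
  calc |uvWeightFn Λ (ppFreq β n) e| * |uvWeightFn Λ (ppFreq β n) u| * |e / (ppFreq β n ^ 2 + e ^ 2) + u / (ppFreq β n ^ 2 + u ^ 2)|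
      ≤ 1 * 1 * (|e| / ppFreq β n ^ 2 + |u| / ppFreq β n ^ 2) :=
        mul_le_mul (mul_le_mul (abs_uvWeightFn_le_one _ _ _) (abs_uvWeightFn_le_one _ _ _) (abs_nonneg _) zero_le_one)
          ((abs_add_le _ _).trans (add_le_add h1 h2)) (abs_nonneg _) (by positivity)
    _ = (|e| + |u|) * (1 / ppFreq β n ^ 2) := by ring

/-- Summability of the `∂ᵤ` summands (the counting-free dominator of `…TrueFlatness`). [folklore] -/
theorem summable_ppSummandDu {β Λ : ℝ} (hβ : 0 < β) (hΛ : 0 < Λ) {B₁ : ℝ} (hB₁ : ∀ x, |deriv salmhoferCutoff x| ≤ B₁) (e u : ℝ) :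
    Summable (ppSummandDu β Λ e u) :=
  Summable.of_norm_bounded (summable_ppDominator hβ B₁ (β / π)) fun n => by
    rw [Real.norm_eq_abs]; exact abs_ppDuSummand_le hβ hΛ hB₁ n e u

/-- **Window + tail**: `N = N_M + N_tail`. [cite: BenfattoGiulianiMastropietro2006, §2.1 (2.3)-(2.4)] -/
theorem ppTrueNumerator_eq_window_add_tail {β : ℝ} (hβ : 0 < β) (Λ : ℝ) (M : ℕ) (e u : ℝ) :
    ppTrueNumerator β Λ e u = ppWindowNumerator β Λ M e u + ppTailNumerator β Λ M e u := by
  rw [ppTrueNumerator_eq_tsum_ppSummand, ppWindowNumerator, ppTailNumerator, ← mul_add, (summable_ppSummand hβ Λ e u).sum_add_tsum_nat_add M]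

/-- **Window + tail for `∂ᵤ`**: `∂ᵤN = ∂ᵤN_M + ∂ᵤN_tail` (as series). [cite: BenfattoGiulianiMastropietro2006, §2.1 (2.3)-(2.4)] -/
theorem ppTrueNumeratorDu_eq_window_add_tail {β Λ : ℝ} (hβ : 0 < β) (hΛ : 0 < Λ) {B₁ : ℝ} (hB₁ : ∀ x, |deriv salmhoferCutoff x| ≤ B₁) (M : ℕ) (e u : ℝ) :
    ppTrueNumeratorDu β Λ e u = ppWindowNumeratorDu β Λ M e u + ppTailNumeratorDu β Λ M e u := by
  rw [ppTrueNumeratorDu_eq_tsum_ppSummandDu, ppWindowNumeratorDu, ppTailNumeratorDu, ← mul_add, (summable_ppSummandDu hβ hΛ hB₁ e u).sum_add_tsum_nat_add M]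

/-- The tail is symmetric in the two levels. [folklore] -/
theorem ppTailNumerator_symm (β Λ : ℝ) (M : ℕ) (e u : ℝ) : ppTailNumerator β Λ M e u = ppTailNumerator β Λ M u e := by
  unfold ppTailNumerator; congr 1; exact tsum_congr fun n => ppSummand_symm β Λ e u _

/-- The window is symmetric in the two levels. [folklore] -/
theorem ppWindowNumerator_symm (β Λ : ℝ) (M : ℕ) (e u : ℝ) : ppWindowNumerator β Λ M e u = ppWindowNumerator β Λ M u e := by
  unfold ppWindowNumerator; congr 1; exact Finset.sum_congr rfl fun n _ => ppSummand_symm β Λ e u _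

/-! ## §2 Derivatives of summands, window and tail -/

/-- **`∂ᵤ` of one summand.** [cite: BenfattoGiulianiMastropietro2006, §2.4 (2.36)] -/
theorem hasDerivAt_ppSummand_u {β : ℝ} (hβ : 0 < β) (Λ e : ℝ) (n : ℕ) (v : ℝ) :
    HasDerivAt (fun y => ppSummand β Λ e y n) (ppSummandDu β Λ e v n) v := by
  have hω := ppFreq_pos hβ n
  have hW : HasDerivAt (fun y => uvWeightFn Λ (ppFreq β n) y) (uvWeightFnD1 Λ (ppFreq β n) v) v := hasDerivAt_uvWeightFn Λ (ppFreq β n) v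
  have hL : HasDerivAt (fun y : ℝ => y / (ppFreq β n ^ 2 + y ^ 2)) ((ppFreq β n ^ 2 - v ^ 2) / (ppFreq β n ^ 2 + v ^ 2) ^ 2) v :=
    hasDerivAt_lorentzian (ppFreq β n) (by positivity)
  have h := ((hW.fun_mul (hL.const_add (e / (ppFreq β n ^ 2 + e ^ 2)))).const_mul (uvWeightFn Λ (ppFreq β n) e))
  refine (h.congr_of_eventuallyEq (Eventually.of_forall fun y => by unfold ppSummand; ring)).congr_deriv ?_
  unfold ppSummandDu
  ring

/-- **`∂ᵤN_M`** (finite sum). [cite: BenfattoGiulianiMastropietro2006, §2.4 (2.36)] -/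
theorem hasDerivAt_ppWindowNumerator_u {β : ℝ} (hβ : 0 < β) (Λ : ℝ) (M : ℕ) (e u : ℝ) :
    HasDerivAt (fun v => ppWindowNumerator β Λ M e v) (ppWindowNumeratorDu β Λ M e u) u := by
  unfold ppWindowNumerator ppWindowNumeratorDu
  exact (HasDerivAt.fun_sum fun n _ => hasDerivAt_ppSummand_u hβ Λ e n u).const_mul _

/-- **`∂ᵤN_tail`** (`= ∂ᵤN − ∂ᵤN_M`). [cite: BenfattoGiulianiMastropietro2006, §2.4 (2.36)] -/
theorem hasDerivAt_ppTailNumerator_u {β Λ : ℝ} (hβ : 0 < β) (hΛ : 0 < Λ) {B₁ : ℝ} (hB₁ : ∀ x, |deriv salmhoferCutoff x| ≤ B₁) (M : ℕ) (e u : ℝ) :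
    HasDerivAt (fun v => ppTailNumerator β Λ M e v) (ppTailNumeratorDu β Λ M e u) u := by
  have hfun : (fun v => ppTailNumerator β Λ M e v) = fun v => ppTrueNumerator β Λ e v - ppWindowNumerator β Λ M e v := by
    funext v; rw [ppTrueNumerator_eq_window_add_tail hβ Λ M e v]; ring
  have hval : ppTailNumeratorDu β Λ M e u = ppTrueNumeratorDu β Λ e u - ppWindowNumeratorDu β Λ M e u := by
    rw [ppTrueNumeratorDu_eq_window_add_tail hβ hΛ hB₁ M e u]; ring
  rw [hfun, hval]
  exact (hasDerivAt_ppTrueNumerator_u hβ hΛ hB₁ e u).sub (hasDerivAt_ppWindowNumerator_u hβ Λ M e u)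

/-- **`∂ₑN_tail`** = `ppTailNumeratorDu β Λ M u e` by symmetry. [cite: BenfattoGiulianiMastropietro2006, §2.4 (2.36)] -/
theorem hasDerivAt_ppTailNumerator_e {β Λ : ℝ} (hβ : 0 < β) (hΛ : 0 < Λ) {B₁ : ℝ} (hB₁ : ∀ x, |deriv salmhoferCutoff x| ≤ B₁) (M : ℕ) (e u : ℝ) :
    HasDerivAt (fun x => ppTailNumerator β Λ M x u) (ppTailNumeratorDu β Λ M u e) e := by
  have hfun : (fun x => ppTailNumerator β Λ M x u) = fun x => ppTailNumerator β Λ M u x := funext fun x => ppTailNumerator_symm β Λ M x u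
  rw [hfun]; exact hasDerivAt_ppTailNumerator_u hβ hΛ hB₁ M u e

/-- **`∂ₑN_M`** = `ppWindowNumeratorDu β Λ M u e` by symmetry. [cite: BenfattoGiulianiMastropietro2006, §2.4 (2.36)] -/
theorem hasDerivAt_ppWindowNumerator_e {β : ℝ} (hβ : 0 < β) (Λ : ℝ) (M : ℕ) (e u : ℝ) :
    HasDerivAt (fun x => ppWindowNumerator β Λ M x u) (ppWindowNumeratorDu β Λ M u e) e := by
  have hfun : (fun x => ppWindowNumerator β Λ M x u) = fun x => ppWindowNumerator β Λ M u x := funext fun x => ppWindowNumerator_symm β Λ M x u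
  rw [hfun]; exact hasDerivAt_ppWindowNumerator_u hβ Λ M u e

/-! ## §3 The tail's gradient -/

/-- **Uniform size of one `∂ᵤ` summand**: `|ppSummandDu n| ≤ (12B₁ + 5)/(ωₙ² + Λ²)` (temperature-free, no weight split). [cite: BenfattoGiulianiMastropietro2006, §2.4 (2.36)] -/
theorem abs_ppSummandDu_le_unif {β Λ : ℝ} (hβ : 0 < β) (hΛ : 0 < Λ) {B₁ : ℝ} (hB₁ : ∀ x, |deriv salmhoferCutoff x| ≤ B₁) (e u : ℝ) (n : ℕ) :
    |ppSummandDu β Λ e u n| ≤ (12 * B₁ + 5) / (ppFreq β n ^ 2 + Λ ^ 2) := by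
  have hB0 := salmhoferB₁_nonneg hB₁
  have hω := ppFreq_pos hβ n
  have h1 := abs_uvWeightFnD1_mul_lorentzian_self_le hB₁ hΛ (ppFreq β n) u
  have h2 := abs_uvWeightFn_mul_lorentzian_le hΛ (ppFreq β n) e
  have h3 := abs_uvWeightFnD1_le_shell hB₁ hΛ (ppFreq β n) u
  have h4 := abs_uvWeightFn_mul_lorentzian_deriv_le hΛ hω.ne' u
  have hWe : |uvWeightFn Λ (ppFreq β n) e| ≤ 1 := abs_uvWeightFn_le_one _ _ _
  have hsplit : ppSummandDu β Λ e u n = uvWeightFn Λ (ppFreq β n) e * (uvWeightFnD1 Λ (ppFreq β n) u * (u / (ppFreq β n ^ 2 + u ^ 2))) +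
      (uvWeightFn Λ (ppFreq β n) e * (e / (ppFreq β n ^ 2 + e ^ 2))) * uvWeightFnD1 Λ (ppFreq β n) u +
      uvWeightFn Λ (ppFreq β n) e * (uvWeightFn Λ (ppFreq β n) u * ((ppFreq β n ^ 2 - u ^ 2) / (ppFreq β n ^ 2 + u ^ 2) ^ 2)) := by
    unfold ppSummandDu; ring
  rw [hsplit]
  have hp1 : |uvWeightFn Λ (ppFreq β n) e * (uvWeightFnD1 Λ (ppFreq β n) u * (u / (ppFreq β n ^ 2 + u ^ 2)))| ≤ 1 * (4 * B₁ / (ppFreq β n ^ 2 + Λ ^ 2)) := by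
    rw [abs_mul]; exact mul_le_mul hWe h1 (abs_nonneg _) zero_le_one
  have hp2 : |uvWeightFn Λ (ppFreq β n) e * (e / (ppFreq β n ^ 2 + e ^ 2)) * uvWeightFnD1 Λ (ppFreq β n) u| ≤
      2 / Λ * (2 * B₁ / Λ * (2 * Λ ^ 2 / (ppFreq β n ^ 2 + Λ ^ 2))) := by
    rw [abs_mul]; exact mul_le_mul h2 h3 (abs_nonneg _) (by positivity)
  have hp3 : |uvWeightFn Λ (ppFreq β n) e * (uvWeightFn Λ (ppFreq β n) u * ((ppFreq β n ^ 2 - u ^ 2) / (ppFreq β n ^ 2 + u ^ 2) ^ 2))| ≤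
      1 * (5 / (ppFreq β n ^ 2 + Λ ^ 2)) := by
    rw [abs_mul]; exact mul_le_mul hWe h4 (abs_nonneg _) zero_le_one
  refine (abs_add_three _ _ _).trans ((add_le_add (add_le_add hp1 hp2) hp3).trans (le_of_eq ?_))
  field_simp
  ring

/-- `ωₙ ≥ ω_M` for `n ≥ M` and the count-free tail majorant `1/(ω_{k+M}² + Λ²) ≤ 2/(ω_{k+M}² + ω_M²)`. [folklore] -/
theorem ppFreq_tail_majorant {β : ℝ} (hβ : 0 < β) (Λ : ℝ) (M k : ℕ) :
    1 / (ppFreq β (k + M) ^ 2 + Λ ^ 2) ≤ 2 * (1 / (ppFreq β (k + M) ^ 2 + ppFreq β M ^ 2)) := by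
  have hωM := ppFreq_pos hβ M
  have hmono : ppFreq β M ≤ ppFreq β (k + M) := by
    unfold ppFreq
    rw [div_le_div_iff_of_pos_right hβ]
    have : (M : ℝ) ≤ ((k + M : ℕ) : ℝ) := by exact_mod_cast Nat.le_add_left M k
    nlinarith [Real.pi_pos]
  have hωk := ppFreq_pos hβ (k + M)
  rw [mul_one_div, div_le_div_iff₀ (by positivity) (by positivity)]
  nlinarith [sq_nonneg Λ, mul_self_le_mul_self hωM.le hmono]

/-- **THE TAIL'S GRADIENT**: `|∂ᵤN_tail(e,u)| ≤ (12B₁ + 5)/ω_M` for all levels (`ω_M = (2M+1)π/β`): the tail of `∂N` is an `O(β/M)` CONSTANT — the `A₃`-type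
price of the finite Matsubara window. [cite: BenfattoGiulianiMastropietro2006, §2.1 (2.3)-(2.4)] -/
theorem abs_ppTailNumeratorDu_le {β Λ : ℝ} (hβ : 0 < β) (hΛ : 0 < Λ) {B₁ : ℝ} (hB₁ : ∀ x, |deriv salmhoferCutoff x| ≤ B₁) (M : ℕ) (e u : ℝ) :
    |ppTailNumeratorDu β Λ M e u| ≤ (12 * B₁ + 5) / ppFreq β M := by
  have hB0 := salmhoferB₁_nonneg hB₁
  have hωM := ppFreq_pos hβ M
  unfold ppTailNumeratorDu
  -- majorant of the shifted summands
  set g : ℕ → ℝ := fun n => 2 * (12 * B₁ + 5) * (1 / (ppFreq β n ^ 2 + ppFreq β M ^ 2)) with hg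
  have hg0 : ∀ n, 0 ≤ g n := fun n => by positivity
  have hsg : Summable g := (summable_one_div_ppFreq_sq_add_sq hβ (ppFreq β M)).mul_left _
  have hbd : ∀ k : ℕ, |ppSummandDu β Λ e u (k + M)| ≤ g (k + M) := fun k => by
    refine (abs_ppSummandDu_le_unif hβ hΛ hB₁ e u (k + M)).trans ?_
    rw [div_eq_mul_one_div]
    calc (12 * B₁ + 5) * (1 / (ppFreq β (k + M) ^ 2 + Λ ^ 2)) ≤ (12 * B₁ + 5) * (2 * (1 / (ppFreq β (k + M) ^ 2 + ppFreq β M ^ 2))) :=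
          mul_le_mul_of_nonneg_left (ppFreq_tail_majorant hβ Λ M k) (by positivity)
      _ = g (k + M) := by simp only [hg]; ring
  have hsgs : Summable fun k : ℕ => g (k + M) := (summable_nat_add_iff M).2 hsg
  have hsf : Summable fun k : ℕ => ppSummandDu β Λ e u (k + M) := Summable.of_norm_bounded hsgs fun k => by rw [Real.norm_eq_abs]; exact hbd k
  -- shifted tail of the majorant ≤ its full sum = closed form
  have htail : ∑' k : ℕ, g (k + M) ≤ ∑' n : ℕ, g n := by
    rw [← hsg.sum_add_tsum_nat_add M]
    have : 0 ≤ ∑ n ∈ Finset.range M, g n := Finset.sum_nonneg fun n _ => hg0 n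
    linarith
  have hfull : ∑' n : ℕ, g n = 2 * (12 * B₁ + 5) * (β * Real.tanh (β * ppFreq β M / 2) / (4 * ppFreq β M)) := by
    rw [hg, tsum_mul_left, tsum_one_div_ppFreq_sq_add_sq hβ hωM.ne']
  have htsum : |∑' k : ℕ, ppSummandDu β Λ e u (k + M)| ≤ 2 * (12 * B₁ + 5) * (β * Real.tanh (β * ppFreq β M / 2) / (4 * ppFreq β M)) := by
    rw [← hfull]
    refine (norm_tsum_le_tsum_norm hsf.norm).trans ((Summable.tsum_le_tsum (fun k => by rw [Real.norm_eq_abs]; exact hbd k) hsf.norm hsgs).trans htail)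
  have ht : Real.tanh (β * ppFreq β M / 2) ≤ 1 := (Real.tanh_lt_one _).le
  have hβ2 : 0 < 2 / β := by positivity
  rw [abs_mul, abs_of_pos hβ2]
  calc 2 / β * |∑' k : ℕ, ppSummandDu β Λ e u (k + M)| ≤ 2 / β * (2 * (12 * B₁ + 5) * (β * Real.tanh (β * ppFreq β M / 2) / (4 * ppFreq β M))) :=
        mul_le_mul_of_nonneg_left htsum hβ2.le
    _ = (12 * B₁ + 5) / ppFreq β M * Real.tanh (β * ppFreq β M / 2) := by field_simp; ring
    _ ≤ (12 * B₁ + 5) / ppFreq β M * 1 := mul_le_mul_of_nonneg_left ht (by positivity)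
    _ = (12 * B₁ + 5) / ppFreq β M := mul_one _

/-- The tail scale in closed form: `(12B₁+5)/ω_M = (12B₁+5)·β/((2M+1)π)` — an `O(β/M)` constant. [folklore] -/
theorem tail_const_eq {β : ℝ} (hβ : 0 < β) (B₁ : ℝ) (M : ℕ) : (12 * B₁ + 5) / ppFreq β M = (12 * B₁ + 5) * β / ((2 * M + 1) * π) := by
  unfold ppFreq
  have hπ := Real.pi_pos
  field_simp

end Summit.HubbardSuperconductivity.HubbardSuperconductivity.Theorems.C4a

end
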